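import Literature.MathematicalPhysics.QuantumFieldTheory.Balaban1983to89.B4Eq19LatticeOperators
import HarnessLib

/-!
# Crux `HistoryTailL` (stmt-QuantumFields-19936), K2 organ of record «LOC-REG-MIN» (`hReg`, route crux `PoincareLipschitz.BlockLipschitzL`, stmt-QuantumFields-23533),
# its regularity half, the E→R road (★w5-19936 g12, memo `E2R-ROAD-w5g12.md`), brick F4-CORE:
# VARIABLE-RADIUS BOX AVERAGING IS ℓ¹-BOUNDED — `Σ_x avg_{Q_{σ(x)+2}(x)} c ≤ (A + B + 1)^d · Σ_y c(y)` when the radii seeing a common point are comparable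

Cell `ym3-torus` (YM ladder rung R3 = continuum SU(2) Yang–Mills on the three-torus — a RUNG, NOT the Clay problem: not d = 4, not infinite
volume, not a mass gap), LEAD seat `ym-ust-19936-w1` gen 8; `--supports stmt-QuantumFields-19936 --as helper`; THEOREMS ONLY, definition-free; imports lit
✓`B4Eq19LatticeOperators` (`Zd d`, `box`) only.

WHY.  Step (iv) of the one-step energy improvement on `ℤ³` (Schoen–Uhlenbeck 1982 §4 without monotonicity, ★w5 g12's road §2): the competitor in the boundary layer is
`w(x) = π(ū_{σ(x)}(x))` with the SHRINKING mollification radius `σ(x) = ⌊θ·depth(x)⌋`, and its energy is bounded bond by bond by box averages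
`avg_{Q_{σ(x)+2}(x)} ‖∇u‖²` (F2's letters).  Summing these over the layer needs the DOUBLE COUNTING «`Σ_x avg_{Q_{σ(x)+2}(x)} ≤ C(θ)·Σ_y`»: a point `y` is seen only by
centres `x` whose radii are comparable (`σ` is θ-Lipschitz, `θ < 1`), so the weights `|Q_{σ(x)+2}|⁻¹` of the centres seeing `y` sum to a constant.  THIS FILE is that counting,
ABSTRACTLY: the only hypothesis on the radius function is the COMPARABILITY `σ(x) ≤ A·σ(x') + B` whenever `Q_{σ(x)+2}(x)` and `Q_{σ(x')+2}(x')` share a point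
(for `σ = ⌊θ·depth⌋`, `θ ≤ ¼`: `A = 2`, `B = 2` — F4 proper's one line), and the constant is `(A + B + 1)^d`.

* §1 `card_le_of_subset_box` (a finset inside `Q_R(y)` has `≤ (2R+1)^d` points), `inv_card_weight_le` (weights decrease with the radius),
  `ratio_pow_le` (`(2(As+B+2)+1)^d·((2(s+2)+1)^d)⁻¹ ≤ (A+B+1)^d`).
* §2 ★ `sum_weights_seeing_le` — for each point `y`: `Σ_{x ∈ X, y ∈ Q_{σ(x)+2}(x)} ((2(σ x+2)+1)^d)⁻¹ ≤ (A + B + 1)^d`.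
* §3 ★★ `sum_boxAvg_varRadius_le` — the double count: `Σ_{x∈X} ((2(σ x+2)+1)^d)⁻¹·Σ_{y∈Q_{σ(x)+2}(x)} c(y) ≤ (A+B+1)^d·Σ_{y∈U} c(y)` for `c ≥ 0` on `U ⊇ ⋃ Q`.
HONEST SCOPE.  Finite combinatorics; nothing of E→R, `hReg`, `BlockLipschitzL`, `HistoryTailL` or any summit statement is proved.  YM₃ on T³ is rung R3, NOT the Clay problem.

References: R. Schoen, K. Uhlenbeck, J. Differential Geom. **17** (1982) 307–335 (§4, the extension lemma — the variable-radius mollifier); M. Giaquinta, *Multiple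
integrals…*, Ann. Math. Stud. 105 [Giaquinta1984] (Ch. III §1, boxes).
-/

set_option autoImplicit false

noncomputable section

open scoped BigOperators
open Finset
open Literature.MathematicalPhysics.QuantumFieldTheory.Balaban1983to89.B4Eq19LatticeOperators

namespace Summit.QuantumFields.YangMills.Theorems.PoincareLipschitzVarRadiusDoubleCount

variable {d : ℕ}

/-! ## §1 Counting letters -/

/-- A finite set inside the box `Q_R(y)` has at most `(2R+1)^d` points (`R ≥ 0`). [cite: Giaquinta1984, Ch. III §1 p.64] -/
theorem card_le_of_subset_box {S : Finset (Zd d)} {y : Zd d} {R : ℤ} (hR : 0 ≤ R) (hS : S ⊆ box y R) :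
    (S.card : ℝ) ≤ ((2 * R + 1 : ℤ) : ℝ) ^ d := by
  rw [← card_box y hR]
  exact_mod_cast Finset.card_le_card hS

/-- The weight `((2(s+2)+1)^d)⁻¹` decreases with the radius: `s ≤ t` ⇒ `((2(t+2)+1)^d)⁻¹ ≤ ((2(s+2)+1)^d)⁻¹` (`s ≥ 0`). [folklore] -/
theorem inv_card_weight_le {s t : ℤ} (hs : 0 ≤ s) (hst : s ≤ t) :
    ((((2 * (t + 2) + 1 : ℤ) : ℝ) ^ d))⁻¹ ≤ ((((2 * (s + 2) + 1 : ℤ) : ℝ) ^ d))⁻¹ := by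
  have h1 : (0 : ℝ) < ((2 * (s + 2) + 1 : ℤ) : ℝ) := by exact_mod_cast (show (0 : ℤ) < 2 * (s + 2) + 1 by linarith)
  have h2 : ((2 * (s + 2) + 1 : ℤ) : ℝ) ≤ ((2 * (t + 2) + 1 : ℤ) : ℝ) := by exact_mod_cast (show (2 * (s + 2) + 1 : ℤ) ≤ 2 * (t + 2) + 1 by linarith)
  exact inv_anti₀ (pow_pos h1 d) (pow_le_pow_left₀ h1.le h2 d)

/-- The ratio of the two counts: `(2(As+B+2)+1)^d · ((2(s+2)+1)^d)⁻¹ ≤ (A+B+1)^d` for `s ≥ 0`, `A ≥ 1`, `B ≥ 0`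
(`2(As+B+2)+1 ≤ (A+B+1)(2(s+2)+1)`). [folklore] -/
theorem ratio_pow_le {s : ℤ} (hs : 0 ≤ s) {A B : ℕ} (hA : 1 ≤ A) :
    ((2 * ((A : ℤ) * s + B + 2) + 1 : ℤ) : ℝ) ^ d * ((((2 * (s + 2) + 1 : ℤ) : ℝ) ^ d))⁻¹ ≤ ((A : ℝ) + B + 1) ^ d := by
  have hpos : (0 : ℝ) < ((2 * (s + 2) + 1 : ℤ) : ℝ) := by exact_mod_cast (show (0 : ℤ) < 2 * (s + 2) + 1 by linarith)
  rw [← div_eq_mul_inv, ← div_pow]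
  apply pow_le_pow_left₀ (div_nonneg (by exact_mod_cast (show (0 : ℤ) ≤ 2 * ((A : ℤ) * s + B + 2) + 1 by positivity)) hpos.le)
  rw [div_le_iff₀ hpos]
  have hA' : (1 : ℝ) ≤ A := by exact_mod_cast hA
  have hB' : (0 : ℝ) ≤ B := Nat.cast_nonneg B
  have hs' : (0 : ℝ) ≤ s := by exact_mod_cast hs
  push_cast
  nlinarith

/-! ## §2 The weights of the centres seeing a fixed point sum to a constant -/

/-- ★ **FOR EACH POINT, THE SEEING WEIGHTS SUM TO `≤ (A+B+1)^d`.**  Let `σ ≥ 0` be a radius function with the comparability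
`y ∈ Q_{σ(x)+2}(x) ∧ y ∈ Q_{σ(x')+2}(x') ⇒ σ(x) ≤ A·σ(x') + B` (`A ≥ 1`).  Then for every finite `X` and every `y`:
`Σ_{x ∈ X, y ∈ Q_{σ(x)+2}(x)} ((2(σ x+2)+1)^d)⁻¹ ≤ (A+B+1)^d` — all centres seeing `y` lie in `Q_{Aσ_min+B+2}(y)` and carry weights `≤ ((2(σ_min+2)+1)^d)⁻¹`.
[folklore] -/
theorem sum_weights_seeing_le (σ : Zd d → ℤ) (hσ : ∀ x, 0 ≤ σ x) (A B : ℕ) (hA : 1 ≤ A)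
    (hcomp : ∀ x x' y : Zd d, y ∈ box x (σ x + 2) → y ∈ box x' (σ x' + 2) → σ x ≤ (A : ℤ) * σ x' + B)
    (X : Finset (Zd d)) (y : Zd d) :
    ∑ x ∈ X.filter (fun x => y ∈ box x (σ x + 2)), ((((2 * (σ x + 2) + 1 : ℤ) : ℝ) ^ d))⁻¹ ≤ ((A : ℝ) + B + 1) ^ d := by
  set S := X.filter (fun x => y ∈ box x (σ x + 2)) with hS
  by_cases hne : S.Nonempty
  · -- the smallest radius among the seeing centres
    obtain ⟨x₀, hx₀, hmin⟩ := S.exists_min_image σ hne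
    have hx₀y : y ∈ box x₀ (σ x₀ + 2) := (Finset.mem_filter.mp hx₀).2
    set s := σ x₀ with hs
    have hs0 : 0 ≤ s := hσ x₀
    -- every seeing centre has radius `≤ A s + B` and lies in `Q_{As+B+2}(y)`
    have hrad : ∀ x ∈ S, σ x ≤ (A : ℤ) * s + B := fun x hx => hcomp x x₀ y (Finset.mem_filter.mp hx).2 hx₀y
    have hsub : S ⊆ box y ((A : ℤ) * s + B + 2) := by
      intro x hx
      have hxy : y ∈ box x (σ x + 2) := (Finset.mem_filter.mp hx).2
      have hyx : x ∈ box y (σ x + 2) := mem_box_comm.mp hxy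
      exact box_mono y (by linarith [hrad x hx]) hyx
    have hR : (0 : ℤ) ≤ (A : ℤ) * s + B + 2 := by positivity
    -- bound each weight by the largest one and count
    calc ∑ x ∈ S, ((((2 * (σ x + 2) + 1 : ℤ) : ℝ) ^ d))⁻¹
        ≤ ∑ x ∈ S, ((((2 * (s + 2) + 1 : ℤ) : ℝ) ^ d))⁻¹ :=
          Finset.sum_le_sum fun x hx => inv_card_weight_le hs0 (hmin x hx)
      _ = (S.card : ℝ) * ((((2 * (s + 2) + 1 : ℤ) : ℝ) ^ d))⁻¹ := by rw [Finset.sum_const, nsmul_eq_mul]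
      _ ≤ ((2 * ((A : ℤ) * s + B + 2) + 1 : ℤ) : ℝ) ^ d * ((((2 * (s + 2) + 1 : ℤ) : ℝ) ^ d))⁻¹ :=
          mul_le_mul_of_nonneg_right (card_le_of_subset_box hR hsub) (inv_nonneg.mpr (pow_nonneg (by positivity) d))
      _ ≤ ((A : ℝ) + B + 1) ^ d := ratio_pow_le hs0 hA
  · rw [Finset.not_nonempty_iff_eq_empty.mp hne, Finset.sum_empty]
    positivity

/-! ## §3 The double count -/

/-- ★★ **VARIABLE-RADIUS BOX AVERAGING IS ℓ¹-BOUNDED.**  Under the comparability hypothesis of §2, for every finite set of centres `X`, every finite `U`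
containing all the boxes `Q_{σ(x)+2}(x)` (`x ∈ X`), and every `c ≥ 0` on `U`:
`Σ_{x∈X} ((2(σ x+2)+1)^d)⁻¹ · Σ_{y ∈ Q_{σ(x)+2}(x)} c(y) ≤ (A + B + 1)^d · Σ_{y∈U} c(y)`.
(F4-core of the E→R road: the layer energy of the variable-radius mollifier is controlled by the energy of the layer, no `s⁻²Σ|u − ū|²` term.)
[folklore] -/
theorem sum_boxAvg_varRadius_le (σ : Zd d → ℤ) (hσ : ∀ x, 0 ≤ σ x) (A B : ℕ) (hA : 1 ≤ A)
    (hcomp : ∀ x x' y : Zd d, y ∈ box x (σ x + 2) → y ∈ box x' (σ x' + 2) → σ x ≤ (A : ℤ) * σ x' + B)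
    (X U : Finset (Zd d)) (hU : ∀ x ∈ X, box x (σ x + 2) ⊆ U) (c : Zd d → ℝ) (hc : ∀ y ∈ U, 0 ≤ c y) :
    ∑ x ∈ X, ((((2 * (σ x + 2) + 1 : ℤ) : ℝ) ^ d))⁻¹ * ∑ y ∈ box x (σ x + 2), c y ≤
      ((A : ℝ) + B + 1) ^ d * ∑ y ∈ U, c y := by
  classical
  -- write the inner sums over `U` with an indicator, swap, and bound per point
  have hinner : ∀ x ∈ X, ((((2 * (σ x + 2) + 1 : ℤ) : ℝ) ^ d))⁻¹ * ∑ y ∈ box x (σ x + 2), c y =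
      ∑ y ∈ U, if y ∈ box x (σ x + 2) then ((((2 * (σ x + 2) + 1 : ℤ) : ℝ) ^ d))⁻¹ * c y else 0 := by
    intro x hx
    rw [Finset.mul_sum, ← Finset.sum_filter]
    congr 1
    ext y
    simp only [Finset.mem_filter]
    constructor
    · intro hy; exact ⟨hU x hx hy, hy⟩
    · intro hy; exact hy.2
  rw [Finset.sum_congr rfl hinner, Finset.sum_comm, Finset.mul_sum]
  refine Finset.sum_le_sum fun y hy => ?_
  rw [← Finset.sum_filter]
  have hw := sum_weights_seeing_le σ hσ A B hA hcomp X y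
  have hcy : 0 ≤ c y := hc y hy
  calc ∑ x ∈ X.filter (fun x => y ∈ box x (σ x + 2)), ((((2 * (σ x + 2) + 1 : ℤ) : ℝ) ^ d))⁻¹ * c y
      = (∑ x ∈ X.filter (fun x => y ∈ box x (σ x + 2)), ((((2 * (σ x + 2) + 1 : ℤ) : ℝ) ^ d))⁻¹) * c y := by
        rw [Finset.sum_mul]
    _ ≤ ((A : ℝ) + B + 1) ^ d * c y := mul_le_mul_of_nonneg_right hw hcy

end Summit.QuantumFields.YangMills.Theorems.PoincareLipschitzVarRadiusDoubleCount

end
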